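import Summits.Ventures.PercRepro.Night2LocalExtra

/-!
# PercRepro — at most three members share an extra set (night-2, gen 7)

`G` a rank-`(q + 1)` flat with exactly one ground element outside it, `S` a set which is the extra set
`B ∪ (G ∖ cl B)` of members `B` of `𝒜` inside `G` (`Night2LocalExtra.lean`).

* `extra_inter_nonempty` (L2a): two such members have intersecting outside pairs `G ∖ cl B`, `G ∖ cl B'` —
  otherwise `E ∖ B ⊆ {w} ∪ cl B'` has rank `≤ q + 1`;
* `eRk_inter_le_of_ne`: two distinct rank-`q` flats meet in rank `≤ q − 1` (submodularity);
* `extra_star_false` (L2b): three distinct such members cannot have a common element `a` in their outside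
  pairs — the third member's complement would lie in `{w} ∪ (cl B₁ ∩ cl B₂) ∪ {a}`, of rank `≤ q + 1`;
* **`card_extraPreimages_le_three`** (L2c): hence at most THREE members have the same extra set (their outside
  pairs are among `{a, b}`, `{a, c}`, `{b, c}`).

This corrects the claim «λ(S) ≤ 2» of `proofs/NIGHT-2-local.md` §8 (C2): `λ(S) = 3` does occur (§13: `G = P ∪
{y, z₁, z₂}` with `P` a parallel pair, `w` a coloop); the matching of `Night2LocalTwoColoop.lean` only needs
`κ = 0` when `λ ≥ 1` and `λ ≤ 3`.
-/

namespace PercRepro.Shadow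

open Finset PerFlat ThmH

variable {α : Type*} [DecidableEq α] {M : Matroid α} [M.Finite]

/-! ## Two members with the same extra set -/

/-- **(L2a)** Two members of `𝒜` inside `G` with the same extra set `S` have intersecting «outside pairs»
`G ∖ cl B`, `G ∖ cl B'`: otherwise `E ∖ B ⊆ {w} ∪ cl B'` has rank `≤ q + 1`. -/
theorem extra_inter_nonempty {q : ℕ} {𝒜 : Finset (Finset α)} (h𝒜 : 𝒜 ⊆ Uq M (q + 2) q) {G : Finset α}
    (hd : (gr M \ G).card = 1) {B B' S : Finset α} (hB : B ∈ membersIn M 𝒜 G) (hS : S ∈ extraSets M G B)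
    (hB' : B' ∈ membersIn M 𝒜 G) (hS' : S ∈ extraSets M G B') :
    ((G \ clF M B) ∩ (G \ clF M B')).Nonempty := by
  rw [mem_extraSets] at hS hS'
  obtain ⟨hBF, hFG, hSB, hBS, hGS, hZS⟩ := extra_facts h𝒜 hB hS.2
  obtain ⟨hBF', hFG', hSB', hBS', hGS', hZS'⟩ := extra_facts h𝒜 hB' hS'.2
  have hBU : B ∈ Uq M (q + 2) q := h𝒜 (mem_membersIn.1 hB).1
  have hB'U : B' ∈ Uq M (q + 2) q := h𝒜 (mem_membersIn.1 hB').1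
  by_contra hempty
  rw [Finset.not_nonempty_iff_eq_empty] at hempty
  apply false_of_compl_subset hBU (X := (gr M \ G) ∪ clF M B') ?_ (eRk_union_compl_le hd (clF_mem_flatsQ hB'U))
  intro x hx
  rw [Finset.mem_sdiff] at hx
  rw [Finset.mem_union]
  by_cases hxG : x ∈ G
  · right
    by_contra hxF'
    have hxZ' : x ∈ G \ clF M B' := Finset.mem_sdiff.2 ⟨hxG, hxF'⟩
    have hxS : x ∈ S := hZS' hxZ'
    have hxZ : x ∈ G \ clF M B := by rw [← hSB]; exact Finset.mem_sdiff.2 ⟨hxS, hx.2⟩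
    have : x ∈ (G \ clF M B) ∩ (G \ clF M B') := Finset.mem_inter.2 ⟨hxZ, hxZ'⟩
    rw [hempty] at this
    exact Finset.notMem_empty _ this
  · exact Or.inl (Finset.mem_sdiff.2 ⟨hx.1, hxG⟩)

/-- Two distinct rank-`q` flats meet in rank `≤ q - 1` (submodularity: their union has rank `≥ q + 1`). -/
theorem eRk_inter_le_of_ne {q : ℕ} {F F' : Finset α}
    (hF : F ∈ flatsQ M q) (hF' : F' ∈ flatsQ M q) (hne : F ≠ F') :
    M.eRk ((F ∩ F' : Finset α) : Set α) + 1 ≤ (q : ℕ∞) := by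
  -- F' ⊄ F, so some y ∈ F' ∖ F and insert y F has rank q + 1 ≤ rank (F ∪ F')
  have hnsub : ¬ F' ⊆ F := fun h => hne (flatsQ_eq_of_subset hF' hF h).symm
  obtain ⟨y, hyF', hyF⟩ := Finset.not_subset.1 hnsub
  have hyE : y ∈ M.E \ M.closure (F : Set α) := by
    refine ⟨by rw [← coe_gr]; exact_mod_cast (mem_flatsQ.1 hF').1 hyF', ?_⟩
    rw [(mem_flatsQ.1 hF).2.1.closure]
    exact_mod_cast hyF
  have hunion : ((q + 1 : ℕ) : ℕ∞) ≤ M.eRk ((F ∪ F' : Finset α) : Set α) := by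
    have h1 : M.eRk ((insert y F : Finset α) : Set α) = ((q + 1 : ℕ) : ℕ∞) := by
      rw [Finset.coe_insert, Matroid.eRk_insert_eq_add_one hyE, (mem_flatsQ.1 hF).2.2]
      push_cast
      rfl
    rw [← h1]
    exact M.eRk_mono (by exact_mod_cast Finset.insert_subset (Finset.mem_union_right _ hyF') Finset.subset_union_left)
  have hsub := M.eRk_inter_add_eRk_union_le (F : Set α) (F' : Set α)
  rw [(mem_flatsQ.1 hF).2.2, (mem_flatsQ.1 hF').2.2] at hsub
  rw [← Finset.coe_inter, ← Finset.coe_union] at *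
  have hfin : M.eRk ((F ∩ F' : Finset α) : Set α) ≤ (q : ℕ∞) := by
    rw [← (mem_flatsQ.1 hF).2.2]
    exact M.eRk_mono (by exact_mod_cast Finset.inter_subset_left)
  obtain ⟨n, hn⟩ := ENat.ne_top_iff_exists.1 (ne_top_of_le_ne_top (ENat.coe_ne_top q) hfin)
  rw [← hn] at hsub ⊢
  have h2 : (n : ℕ∞) + ((q + 1 : ℕ) : ℕ∞) ≤ (q : ℕ∞) + (q : ℕ∞) := (add_le_add (le_refl (n : ℕ∞)) hunion).trans hsub
  have h3 : n + (q + 1) ≤ q + q := by exact_mod_cast h2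
  have h4 : n + 1 ≤ q := by omega
  exact_mod_cast h4

/-- **(L2b)** Three distinct members of `𝒜` inside `G` with the same extra set `S` cannot have a common element
`a` in their outside pairs: the third member's complement would lie in `{w} ∪ (cl B₁ ∩ cl B₂) ∪ {a}`, of rank
`≤ q + 1`. -/
theorem extra_star_false {q : ℕ} {𝒜 : Finset (Finset α)} (h𝒜 : 𝒜 ⊆ Uq M (q + 2) q) {G : Finset α}
    (hG : G ∈ flatsQ M (q + 1)) (hd : (gr M \ G).card = 1) {B₁ B₂ B₃ S : Finset α}
    (hB₁ : B₁ ∈ membersIn M 𝒜 G) (hS₁ : S ∈ extraSets M G B₁)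
    (hB₂ : B₂ ∈ membersIn M 𝒜 G) (hS₂ : S ∈ extraSets M G B₂)
    (hB₃ : B₃ ∈ membersIn M 𝒜 G) (hS₃ : S ∈ extraSets M G B₃)
    (h12 : B₁ ≠ B₂) (h13 : B₁ ≠ B₃) (h23 : B₂ ≠ B₃) {a : α}
    (ha₁ : a ∈ G \ clF M B₁) (ha₂ : a ∈ G \ clF M B₂) (ha₃ : a ∈ G \ clF M B₃) : False := by
  rw [mem_extraSets] at hS₁ hS₂ hS₃
  obtain ⟨hBF₁, hFG₁, hSB₁, hBS₁, hGS₁, hZS₁⟩ := extra_facts h𝒜 hB₁ hS₁.2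
  obtain ⟨hBF₂, hFG₂, hSB₂, hBS₂, hGS₂, hZS₂⟩ := extra_facts h𝒜 hB₂ hS₂.2
  obtain ⟨hBF₃, hFG₃, hSB₃, hBS₃, hGS₃, hZS₃⟩ := extra_facts h𝒜 hB₃ hS₃.2
  have hB₁U : B₁ ∈ Uq M (q + 2) q := h𝒜 (mem_membersIn.1 hB₁).1
  have hB₂U : B₂ ∈ Uq M (q + 2) q := h𝒜 (mem_membersIn.1 hB₂).1
  have hB₃U : B₃ ∈ Uq M (q + 2) q := h𝒜 (mem_membersIn.1 hB₃).1
  have hGg : G ⊆ gr M := (mem_flatsQ.1 hG).1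
  -- the closures of B₁ and B₂ are distinct flats
  have hFne : clF M B₁ ≠ clF M B₂ := by
    intro h
    apply h12
    rw [hBS₁, hBS₂, h]
  -- E ∖ B₃ ⊆ (E ∖ G) ∪ insert a (cl B₁ ∩ cl B₂)
  have hsub : gr M \ B₃ ⊆ (gr M \ G) ∪ insert a (clF M B₁ ∩ clF M B₂) := by
    intro x hx
    rw [Finset.mem_sdiff] at hx
    rw [Finset.mem_union, Finset.mem_insert, Finset.mem_inter]
    by_cases hxG : x ∈ G
    · right
      by_cases hxa : x = a
      · exact Or.inl hxa
      · right
        by_cases hxS : x ∈ S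
        · -- x ∈ S ∖ B₃ = G ∖ cl B₃ = {a, x₃}; x ≠ a, so x is the other element, which lies in B₁ and B₂
          have hxZ₃ : x ∈ G \ clF M B₃ := by rw [← hSB₃]; exact Finset.mem_sdiff.2 ⟨hxS, hx.2⟩
          -- x ∉ G ∖ cl B₁ : otherwise G ∖ cl B₁ = {a, x} = G ∖ cl B₃, so B₁ = B₃
          have key : ∀ {B : Finset α}, B ∈ membersIn M 𝒜 G → S = B ∪ (G \ clF M B) →
              (G \ clF M B).card = 2 → a ∈ G \ clF M B → B ≠ B₃ → x ∉ G \ clF M B := by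
            intro B hB hSB hc haB hne hxB
            apply hne
            have hfacts := extra_facts h𝒜 hB hSB
            have heq : G \ clF M B = G \ clF M B₃ := by
              apply Finset.eq_of_subset_of_card_le
              · intro y hy
                have hy' : y ∈ ({a, x} : Finset α) := by
                  have hpair : ({a, x} : Finset α) ⊆ G \ clF M B :=
                    Finset.insert_subset haB (Finset.singleton_subset_iff.2 hxB)
                  have hcard : ({a, x} : Finset α).card = 2 := Finset.card_pair (Ne.symm hxa)
                  rw [Finset.eq_of_subset_of_card_le hpair (by rw [hc, hcard])]
                  exact hy
                rw [Finset.mem_insert, Finset.mem_singleton] at hy'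
                rcases hy' with rfl | rfl
                · exact ha₃
                · exact hxZ₃
              · rw [hc, hS₃.1]
            rw [hfacts.2.2.2.1, hBS₃, heq]
          have hx₁ : x ∉ G \ clF M B₁ := key hB₁ hS₁.2 hS₁.1 ha₁ h13
          have hx₂ : x ∉ G \ clF M B₂ := key hB₂ hS₂.2 hS₂.1 ha₂ h23
          exact ⟨by by_contra h; exact hx₁ (Finset.mem_sdiff.2 ⟨hxG, h⟩),
            by by_contra h; exact hx₂ (Finset.mem_sdiff.2 ⟨hxG, h⟩)⟩
        · exact ⟨hGS₁ (Finset.mem_sdiff.2 ⟨hxG, hxS⟩), hGS₂ (Finset.mem_sdiff.2 ⟨hxG, hxS⟩)⟩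
    · exact Or.inl (Finset.mem_sdiff.2 ⟨hx.1, hxG⟩)
  -- rank of insert a (cl B₁ ∩ cl B₂) is ≤ q, so the right-hand side has rank ≤ q + 1
  have hrank : M.eRk (((gr M \ G) ∪ insert a (clF M B₁ ∩ clF M B₂) : Finset α) : Set α) ≤
      ((q + 1 : ℕ) : ℕ∞) := by
    obtain ⟨w, hw⟩ := Finset.card_eq_one.1 hd
    rw [hw, Finset.singleton_union, Finset.coe_insert, Finset.coe_insert]
    have h1 := eRk_inter_le_of_ne (clF_mem_flatsQ hB₁U) (clF_mem_flatsQ hB₂U) hFne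
    calc M.eRk (insert w (insert a ((clF M B₁ ∩ clF M B₂ : Finset α) : Set α)))
        ≤ M.eRk (insert a ((clF M B₁ ∩ clF M B₂ : Finset α) : Set α)) + 1 := M.eRk_insert_le_add_one _ _
      _ ≤ M.eRk ((clF M B₁ ∩ clF M B₂ : Finset α) : Set α) + 1 + 1 :=
          add_le_add (M.eRk_insert_le_add_one _ _) (le_refl 1)
      _ ≤ (q : ℕ∞) + 1 := add_le_add h1 (le_refl 1)
      _ = ((q + 1 : ℕ) : ℕ∞) := by push_cast; rfl
  exact false_of_compl_subset hB₃U hsub hrank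


/-- **(L2c)** At most three members of `𝒜` inside `G` have the same extra set `S`: their outside pairs pairwise
intersect (L2a) and no three of them share an element (L2b), so they are among `{a,b}`, `{a,c}`, `{b,c}`. -/
theorem card_extraPreimages_le_three {q : ℕ} {𝒜 : Finset (Finset α)} (h𝒜 : 𝒜 ⊆ Uq M (q + 2) q) {G : Finset α}
    (hG : G ∈ flatsQ M (q + 1)) (hd : (gr M \ G).card = 1) (S : Finset α) :
    ((membersIn M 𝒜 G).filter (fun B => S ∈ extraSets M G B)).card ≤ 3 := by
  classical
  set 𝓛 := (membersIn M 𝒜 G).filter (fun B => S ∈ extraSets M G B) with h𝓛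
  have hmem : ∀ B ∈ 𝓛, B ∈ membersIn M 𝒜 G ∧ S ∈ extraSets M G B := fun B hB => Finset.mem_filter.1 hB
  have hBS : ∀ B ∈ 𝓛, B ⊆ S := by
    intro B hB
    obtain ⟨-, h2⟩ := hmem B hB
    rw [mem_extraSets] at h2
    rw [h2.2]
    exact Finset.subset_union_left
  have hZ : ∀ B ∈ 𝓛, S \ B = G \ clF M B := fun B hB =>
    (extra_facts h𝒜 (hmem B hB).1 (mem_extraSets.1 (hmem B hB).2).2).2.2.1
  have hinj : Set.InjOn (fun B => S \ B) (𝓛 : Set (Finset α)) := by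
    intro B hB B' hB' h
    rw [Finset.mem_coe] at hB hB'
    have h' : S \ B = S \ B' := h
    calc B = S \ (S \ B) := (Finset.sdiff_sdiff_eq_self (hBS B hB)).symm
      _ = S \ (S \ B') := by rw [h']
      _ = B' := Finset.sdiff_sdiff_eq_self (hBS B' hB')
  rcases Nat.lt_or_ge 1 𝓛.card with hgt | hle
  · obtain ⟨B₁, hB₁, B₂, hB₂, hne⟩ := Finset.one_lt_card.1 hgt
    have hc₁ : (G \ clF M B₁).card = 2 := (mem_extraSets.1 (hmem B₁ hB₁).2).1
    have hc₂ : (G \ clF M B₂).card = 2 := (mem_extraSets.1 (hmem B₂ hB₂).2).1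
    obtain ⟨a, ha⟩ := extra_inter_nonempty h𝒜 hd (hmem B₁ hB₁).1 (hmem B₁ hB₁).2 (hmem B₂ hB₂).1 (hmem B₂ hB₂).2
    rw [Finset.mem_inter] at ha
    obtain ⟨b, hb⟩ := Finset.card_eq_one.1
      (show ((G \ clF M B₁).erase a).card = 1 by rw [Finset.card_erase_of_mem ha.1, hc₁])
    obtain ⟨c, hc⟩ := Finset.card_eq_one.1
      (show ((G \ clF M B₂).erase a).card = 1 by rw [Finset.card_erase_of_mem ha.2, hc₂])
    have hZ₁ : G \ clF M B₁ = {a, b} := by rw [← Finset.insert_erase ha.1, hb]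
    have hZ₂ : G \ clF M B₂ = {a, c} := by rw [← Finset.insert_erase ha.2, hc]
    have hba : b ≠ a := (Finset.mem_erase.1 (hb ▸ Finset.mem_singleton_self b)).1
    have hca : c ≠ a := (Finset.mem_erase.1 (hc ▸ Finset.mem_singleton_self c)).1
    have hbc : b ≠ c := by
      intro h
      apply hne
      rw [← Finset.sdiff_sdiff_eq_self (hBS B₁ hB₁), ← Finset.sdiff_sdiff_eq_self (hBS B₂ hB₂),
        hZ B₁ hB₁, hZ B₂ hB₂, hZ₁, hZ₂, h]
    have hmaps : Set.MapsTo (fun B => S \ B) (𝓛 : Set (Finset α))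
        (({{a, b}, {a, c}, {b, c}} : Finset (Finset α)) : Set (Finset α)) := by
      intro B₃ hB₃
      rw [Finset.mem_coe] at hB₃
      rw [Finset.mem_coe, Finset.mem_insert, Finset.mem_insert, Finset.mem_singleton]
      show S \ B₃ = {a, b} ∨ S \ B₃ = {a, c} ∨ S \ B₃ = {b, c}
      rw [hZ B₃ hB₃]
      by_cases h₁ : B₃ = B₁
      · left; rw [h₁, hZ₁]
      by_cases h₂ : B₃ = B₂
      · right; left; rw [h₂, hZ₂]
      by_cases ha₃ : a ∈ G \ clF M B₃
      · exact (extra_star_false h𝒜 hG hd (hmem B₁ hB₁).1 (hmem B₁ hB₁).2 (hmem B₂ hB₂).1 (hmem B₂ hB₂).2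
          (hmem B₃ hB₃).1 (hmem B₃ hB₃).2 hne (Ne.symm h₁) (Ne.symm h₂) ha.1 ha.2 ha₃).elim
      · right; right
        obtain ⟨x, hx⟩ := extra_inter_nonempty h𝒜 hd (hmem B₃ hB₃).1 (hmem B₃ hB₃).2 (hmem B₁ hB₁).1 (hmem B₁ hB₁).2
        rw [Finset.mem_inter, hZ₁, Finset.mem_insert, Finset.mem_singleton] at hx
        have hbZ₃ : b ∈ G \ clF M B₃ := by
          rcases hx.2 with rfl | rfl
          · exact absurd hx.1 ha₃
          · exact hx.1
        obtain ⟨y, hy⟩ := extra_inter_nonempty h𝒜 hd (hmem B₃ hB₃).1 (hmem B₃ hB₃).2 (hmem B₂ hB₂).1 (hmem B₂ hB₂).2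
        rw [Finset.mem_inter, hZ₂, Finset.mem_insert, Finset.mem_singleton] at hy
        have hcZ₃ : c ∈ G \ clF M B₃ := by
          rcases hy.2 with rfl | rfl
          · exact absurd hy.1 ha₃
          · exact hy.1
        symm
        apply Finset.eq_of_subset_of_card_le (Finset.insert_subset hbZ₃ (Finset.singleton_subset_iff.2 hcZ₃))
        rw [(mem_extraSets.1 (hmem B₃ hB₃).2).1, Finset.card_pair hbc]
    exact (Finset.card_le_card_of_injOn (fun B => S \ B) hmaps hinj).trans Finset.card_le_three
  · omega

end PercRepro.Shadow
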